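import Literature.AlgebraicGeometry.ModuliOfAbelianVarieties.SiegelFineModuliArtinianLifting
import Literature.AlgebraicGeometry.ModuliOfAbelianVarieties.SiegelFineModuliArtinianLiftingPolarizedPrincipal -- ★ p795680 (A2♯) junction-P
import Literature.AlgebraicGeometry.AbelianSchemes.PolarizedLiftOfLineBundleLift -- ★ p793948 (7) α2 ⊕ α3
import Literature.AlgebraicGeometry.AbelianSchemes.ProjectiveOfLiftOfPolarizedFibre -- ★ p792245 αP
import Literature.AlgebraicGeometry.AbelianSchemes.AbelianSchemeLDeltaOfLambdaGlobal
import Literature.AlgebraicGeometry.AbelianSchemes.AbelianSchemeLiftRelDim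
import Literature.AlgebraicGeometry.Morphisms.ProjectiveMorphism
import Summits.HodgeConjecture.HodgeConjecture.Theorems.F11StubG0CoefficientField -- ★ p792666 G0 `stubG0_holds`
import Summits.HodgeConjecture.HodgeConjecture.Theorems.F3DualAbelianSchemeStubF3 -- ★ p797885 T4: α2′ `F11SmoothRoadA.stub_dualPairOfLift_holds`
import Summits.HodgeConjecture.HodgeConjecture.Theorems.F11StubG1AbelianLift -- ★ MONO-G1: G1-P `F11StubG1AbelianLift.stubG1_holds` (letter 99fa7c9e868f3f59)
import Summits.HodgeConjecture.HodgeConjecture.Theorems.F11StubG2LineBundleLift -- ★ MONO-G2: G2-P `F11StubG2LineBundleLift.stubG2_holds` (letter e7db1ea7c18e4d6f)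
import HarnessLib

/-!
# F-11 road A — the Theorems-homed TWIN of the registered letter `stub_F11` (B-p05 (g20), 2026-08-31; F0P1b-plan (g2) (R124): ONE file, both heads)

HC_CM is proved only modulo the 7 printed citations until rung 0 closes; nothing here is about HC.  Count-neutral: this file is the
`Theorems/`-homed twin that the P1 head `Cruxes/HDel/Lines/F0_SiegelModuli.lean` ED. 1.8 folds `stub_F11` over (F0P1-plan (g0) socket cert
`CERT-F0-SiegelModuli.ed1.8.F11fold.socket` d6bf86b5; EDITION-BOOK RULING B-plan1 (g20) 2026-08-30T23:10:50Z: editions import Theorems ∕ Literature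
twins, never `Cruxes/…/Lines` workfiles), and the α1-P rider the parent line `Cruxes/HDel/Lines/F11SmoothRoadA.lean` ED. 5 closes its last `sorry`
`stub_liftWithLineBundle` by (`:= stub_liftWithLineBundle_holds g`, the T4 way).

INPUTS BY NAME (all ★): G0 `F11StubG0CoefficientField.stubG0_holds` (p792666) · G1-P `F11StubG1AbelianLift.stubG1_holds` (MONO-G1, F0P1c-p05 (g2);
letter = grandchild `Cruxes/HDel/Lines/F11LiftWithLineBundle.lean` v0.2P :101–107, declsig 99fa7c9e868f3f59) · G2-P `F11StubG2LineBundleLift.stubG2_holds`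
(MONO-G2, B-p13 (g22) ∕ F0P1c-p02 (g2); letter = grandchild :122–135, declsig e7db1ea7c18e4d6f) · αP p792245 · α2′ p797885 · (7) p793948 · (A2♯) p795680.
Imports ★ tree modules only (Theorems ∕ Literature; never `Cruxes/…/Lines` workfiles).  0 `sorry`; every declaration's axioms ⊆ {propext, Classical.choice, Quot.sound}.

THE TWO HEADS (statements token for token):
* `stub_liftWithLineBundle_holds (g)` = parent ED. 4 bf1a9381 :139–149 α1-P letter (declsig d9e8accf634190ac) := G0 ★ `F11StubG0CoefficientField.stubG0_holds`
  ▸ G1-P ▸ G2-P (the grandchild's composition :152–158 token for token).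
* `stub_F11_holds` = registry `Cruxes/HDel/Lines/F1ExtHodgeType.lean` v5.9 :327 `stub_F11` letter (declsig 132e5f0bcf75cd5d) := parent ED. 4 body
  :171–271 token for token — αP ★ p792245 `AbelianSchemeOver.isProjective_of_isBaseChangeVia_of_iso_pullback_LDelta`, α2′ ★ p797885
  `F11SmoothRoadA.stub_dualPairOfLift_holds`, ★ p793948 (7) `AbelianSchemeOver.exists_polarizedLift_of_lineBundle_lift`, junction-P ★ p795680 (A2♯)
  `SiegelFineModuliScheme.smooth_of_forall_principalSmallExtension_exists_polarizedLift` — over `stub_liftWithLineBundle_holds`.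
New names strictly below those heads carry the suffix `_holds`/are private; no FQN of the parent Lines file is re-declared.
-/

noncomputable section

open CategoryTheory CategoryTheory.Limits AlgebraicGeometry IsLocalRing
open Literature.AlgebraicGeometry.AbelianSchemes Literature.AlgebraicGeometry.ModuliOfAbelianVarieties
  Literature.AlgebraicGeometry.Modules Literature.AlgebraicGeometry.Motives
open Literature.AlgebraicGeometry.Morphisms (IsProjective)

namespace Summit.HodgeConjecture.CorCM.Cruxes.HypDel.F11SmoothRoadA

/-! ### §1 α1-P by name (rider in the parent namespace; the grandchild's composition G0 ▸ G1 ▸ G2) -/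

/-- **α1-P — the letter of `F11SmoothRoadA.stub_liftWithLineBundle` (parent ED. 4) VERBATIM, PROVED by the grandchild line's composition:**
take a coefficient field (G0 ★ `F11StubG0CoefficientField.stubG0_holds`), some abelian lift (G1-P), and move it until it carries the bundle (G2-P).
For `A` Artinian local with `ℚ ⊆ A`, `t ∈ 𝔪_A`, `t ≠ 0`, `𝔪_A·(t) = 0`, an abelian scheme `A₀` of relative dimension `g` over `Spec (A⧸(t))` with a
dual pair `D₀` and a polarisation `λ₀` with graph `Gr₀ = (1, λ₀)`: there are an abelian scheme `X` of relative dimension `g` over `Spec A`, a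
base-change square `G : A₀ → X`, and a rank-one `L` on `X` rigidified along `ε_X` with `G^*L ≅ Gr₀^*𝒫₀ = L^Δ(λ₀)`.
[cite: MumfordFogartyKirwan1994, App. 7A (pp. 234–235)] [cite: Oort1971, §2.2–2.4] [cite: Schlessinger1968, (1.2)–(1.3) (p. 209)] -/
theorem stub_liftWithLineBundle_holds (g : ℕ) :
    ∀ (A : Type) [CommRing A] [Algebra ℚ A] [IsArtinianRing A] [IsLocalRing A] (t : A),
      t ≠ 0 → t ∈ maximalIdeal A → maximalIdeal A * Ideal.span {t} = ⊥ →
      ∀ (A₀ : AbelianSchemeOver (Spec (.of (A ⧸ Ideal.span {t})))) (_ : A₀.IsOfRelDim g) (D₀ : A₀.DualPair) (pol₀ : A₀.Polarization D₀)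
        (Gr₀ : A₀.X.left ⟶ A₀.prodLeft D₀.hat) (_ : Gr₀ ≫ pullback.fst A₀.X.hom D₀.hat.X.hom = 𝟙 _)
        (_ : Gr₀ ≫ pullback.snd A₀.X.hom D₀.hat.X.hom = pol₀.lam.left),
        ∃ (X : AbelianSchemeOver (Spec (.of A))) (_ : X.IsOfRelDim g) (G : A₀.X.left ⟶ X.X.left)
          (_ : A₀.IsBaseChangeVia X (Spec.map (CommRingCat.ofHom (Ideal.Quotient.mk (Ideal.span {t})))) G)
          (L : X.left.Modules) (hL : HasRank L 1)
          (_ : CechPic.pullback X.unitSection (detClass (HasRank.isFiniteLocallyFree' hL)) = 1),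
          Nonempty ((Scheme.Modules.pullback G).obj L ≅ (Scheme.Modules.pullback Gr₀).obj D₀.P) := by
  intro A _ _ _ _ t ht0 htm hJ A₀ hA₀ D₀ pol₀ Gr₀ hGr₁ hGr₂
  -- G0: a coefficient field (★ p792666)
  obtain ⟨k, _instF, _instA, hk⟩ :=
    Summit.HodgeConjecture.HodgeConjecture.Cruxes.HDel.F11StubG0CoefficientField.stubG0_holds A
  -- G1-P: some abelian lift (★ MONO-G1 `F11StubG1AbelianLift.stubG1_holds`)
  obtain ⟨X₁, _hX₁, G₁, hG₁⟩ :=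
    Summit.HodgeConjecture.HodgeConjecture.Cruxes.HDel.F11StubG1AbelianLift.stubG1_holds g A k hk t ht0 htm hJ A₀ hA₀
  -- G2-P: move it until it carries the bundle (★ MONO-G2 `F11StubG2LineBundleLift.stubG2_holds`)
  exact Summit.HodgeConjecture.HodgeConjecture.Cruxes.HDel.F11StubG2LineBundleLift.stubG2_holds g A k hk t ht0 htm hJ A₀ hA₀ D₀ pol₀
    Gr₀ hGr₁ hGr₂ X₁ G₁ hG₁

/-! ### §2 the parent body over ★ names (ED. 4 :163–256 token for token, stub names ↦ ★ FQNs ∕ `_holds`) -/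

/-- `2 ≠ 0` in the residue fields of a scheme over a field of characteristic `0`. [folklore] -/
private theorem two_ne_zero_residueField' {K : Type} [Field K] [CharZero K] {S : Scheme.{0}} (f : S ⟶ Spec (.of K)) (s : S) :
    (2 : S.residueField s) ≠ 0 := by
  let φ : K →+* S.residueField s := (Spec.preimage (S.fromSpecResidueField s ≫ f)).hom
  have h : φ 2 = 2 := map_ofNat φ 2
  rw [← h]
  exact (map_ne_zero φ).mpr two_ne_zero

/-- `Spec` of an Artinian local ring is one point, hence preconnected. [folklore] -/
private theorem preconnectedSpace_spec_of_isArtinian_isLocal' (A : Type) [CommRing A] [IsArtinianRing A] [IsLocalRing A] :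
    PreconnectedSpace (Spec (.of A) : Scheme.{0}) := by
  haveI : Subsingleton (Spec (.of A) : Scheme.{0}) := ⟨fun p q => PrimeSpectrum.ext
    ((IsLocalRing.eq_maximalIdeal (IsArtinianRing.isMaximal_of_isPrime (p : PrimeSpectrum A).asIdeal)).trans
      (IsLocalRing.eq_maximalIdeal (IsArtinianRing.isMaximal_of_isPrime (q : PrimeSpectrum A).asIdeal)).symm)⟩
  exact ⟨Set.subsingleton_univ.isPreconnected⟩

/-- **`stub_polarizedLift` of the parent line, PROVED over ★ names** (ED. 4 :204–256 token for token; cut α assembled: ★ (7)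
`exists_polarizedLift_of_lineBundle_lift` = α2 (★ dual transport) ⊕ α3 (`Λ(L) = [2] ≫ λ`); α1-P = `stub_liftWithLineBundle_holds`; αP = ★ p792245;
α2′ = ★ p797885): polarised abelian schemes with their dual pair lift along a PRINCIPAL small extension `A ↠ A⧸(t)` (`t ≠ 0`, `t ∈ 𝔪_A`,
`𝔪_A·(t) = 0`) of Artinian local `ℚ`-algebras — the shape ★ (A2♯) consumes; `(t) ≠ ⊤` is derived inside.
[cite: MumfordFogartyKirwan1994, Ch. 6 §2 Proposition 6.10–6.11 (pp. 121–122) and App. 7A (pp. 234–235)] -/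
theorem stub_polarizedLift_holds (g : ℕ) :
    ∀ (A : Type) [CommRing A] [Algebra ℚ A] [IsArtinianRing A] [IsLocalRing A] (t : A),
      t ≠ 0 → t ∈ maximalIdeal A → maximalIdeal A * Ideal.span {t} = ⊥ →
      ∀ (A₀ : AbelianSchemeOver (Spec (.of (A ⧸ Ideal.span {t})))) (_ : A₀.IsOfRelDim g) (D₀ : A₀.DualPair)
        (_ : Nonempty ((Scheme.Modules.pullback (AbelianSchemeOver.DualPair.unitHatSlice D₀)).obj D₀.P ≅
          SheafOfModules.unit _))
        (pol₀ : A₀.Polarization D₀),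
        ∃ (X : AbelianSchemeOver (Spec (.of A))) (_ : X.IsOfRelDim g) (D : X.DualPair) (pol : X.Polarization D)
          (G : A₀.X.left ⟶ X.X.left) (Ĝ : D₀.hat.X.left ⟶ D.hat.X.left)
          (hG : A₀.IsBaseChangeVia X (Spec.map (CommRingCat.ofHom (Ideal.Quotient.mk (Ideal.span {t})))) G)
          (hĜ : D₀.hat.IsBaseChangeVia D.hat (Spec.map (CommRingCat.ofHom (Ideal.Quotient.mk (Ideal.span {t})))) Ĝ),
          Nonempty ((Scheme.Modules.pullback
            (pullback.map A₀.X.hom D₀.hat.X.hom X.X.hom D.hat.X.hom G Ĝ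
              (Spec.map (CommRingCat.ofHom (Ideal.Quotient.mk (Ideal.span {t})))) hG.fst.symm hĜ.fst.symm)).obj D.P ≅ D₀.P) ∧
          pol₀.lam.left ≫ Ĝ = G ≫ pol.lam.left := by
  intro A _ _ _ _ t ht0 htm hJ A₀ hA₀ D₀ hD₀ pol₀
  -- the principal ideal `(t)` is proper since `t ∈ 𝔪_A` (as ★ (A2♯) p795680 derives it)
  have hJtop : Ideal.span {t} ≠ ⊤ := fun h =>
    (IsLocalRing.mem_maximalIdeal _).mp htm (Ideal.span_singleton_eq_top.mp h)
  haveI := pol₀.isMonHom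
  -- the graph of `λ₀`
  let Gr₀ : A₀.X.left ⟶ A₀.prodLeft D₀.hat :=
    pullback.lift (𝟙 _) pol₀.lam.left (by rw [Category.id_comp]; exact (Over.w pol₀.lam).symm)
  have hGr₁ : Gr₀ ≫ pullback.fst A₀.X.hom D₀.hat.X.hom = 𝟙 _ := pullback.lift_fst _ _ _
  have hGr₂ : Gr₀ ≫ pullback.snd A₀.X.hom D₀.hat.X.hom = pol₀.lam.left := pullback.lift_snd _ _ _
  -- α1-P: lift the pair (G0 ▸ G1-P ▸ G2-P)
  obtain ⟨X, hX, G, hG, L, hL, hε, hLΔ⟩ := stub_liftWithLineBundle_holds g A t ht0 htm hJ A₀ hA₀ D₀ pol₀ Gr₀ hGr₁ hGr₂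
  -- the lift is projective (junction αP ★ p792245), so F-3 at the Artin base gives some dual pair of it (α2′ ★ p797885)
  have hXproj : IsProjective X.X.hom :=
    AbelianSchemeOver.isProjective_of_isBaseChangeVia_of_iso_pullback_LDelta (Ideal.span {t}) hJtop A₀ D₀ pol₀ Gr₀ hGr₁ hGr₂
      X G hG L hL hLΔ
  obtain ⟨DX⟩ := stub_dualPairOfLift_holds g A X hX hXproj
  -- the bases: connected, locally Noetherian, non-empty, `2` invertible
  haveI : Nontrivial (A ⧸ Ideal.span {t}) := Ideal.Quotient.nontrivial_iff.mpr hJtop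
  haveI : IsLocalRing (A ⧸ Ideal.span {t}) :=
    IsLocalRing.of_surjective' (Ideal.Quotient.mk (Ideal.span {t})) Ideal.Quotient.mk_surjective
  haveI : IsClosedImmersion (Spec.map (CommRingCat.ofHom (Ideal.Quotient.mk (Ideal.span {t})))) :=
    IsClosedImmersion.spec_of_surjective _ Ideal.Quotient.mk_surjective
  haveI : Surjective (Spec.map (CommRingCat.ofHom (Ideal.Quotient.mk (Ideal.span {t})))) := ⟨by
    intro y
    obtain ⟨M, hM⟩ := Ideal.exists_maximal (A ⧸ Ideal.span {t})
    refine ⟨(⟨M, hM.isPrime⟩ : PrimeSpectrum (A ⧸ Ideal.span {t})), PrimeSpectrum.ext ?_⟩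
    rw [IsLocalRing.eq_maximalIdeal (IsArtinianRing.isMaximal_of_isPrime y.asIdeal)]
    exact IsLocalRing.eq_maximalIdeal (IsArtinianRing.isMaximal_of_isPrime _)⟩
  haveI : PreconnectedSpace (Spec (.of A) : Scheme.{0}) := preconnectedSpace_spec_of_isArtinian_isLocal' A
  haveI : PreconnectedSpace (Spec (.of (A ⧸ Ideal.span {t})) : Scheme.{0}) :=
    preconnectedSpace_spec_of_isArtinian_isLocal' (A ⧸ Ideal.span {t})
  haveI : Nonempty (Spec (.of (A ⧸ Ideal.span {t})) : Scheme.{0}) :=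
    ⟨(⟨maximalIdeal (A ⧸ Ideal.span {t}), (maximalIdeal.isMaximal (A ⧸ Ideal.span {t})).isPrime⟩ : PrimeSpectrum (A ⧸ Ideal.span {t}))⟩
  have h2 : ∀ s : (Spec (.of A) : Scheme.{0}), (2 : (Spec (.of A)).residueField s) ≠ 0 :=
    two_ne_zero_residueField' (Spec.map (CommRingCat.ofHom (algebraMap ℚ A)))
  have h2₀ : ∀ s : (Spec (.of (A ⧸ Ideal.span {t})) : Scheme.{0}), (2 : (Spec (.of (A ⧸ Ideal.span {t}))).residueField s) ≠ 0 :=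
    two_ne_zero_residueField' (Spec.map (CommRingCat.ofHom (algebraMap ℚ (A ⧸ Ideal.span {t}))))
  -- α2 ⊕ α3 (★ p793948 (7))
  obtain ⟨D, pol, Ĝ, hĜ, hP, hlam⟩ := AbelianSchemeOver.exists_polarizedLift_of_lineBundle_lift (X := X)
    (i := Spec.map (CommRingCat.ofHom (Ideal.Quotient.mk (Ideal.span {t})))) h2 h2₀ hG D₀ hD₀ pol₀ Gr₀ hGr₁ hGr₂ DX hL hε hLΔ
  exact ⟨X, hX, D, pol, G, Ĝ, hG, hĜ, hP, hlam⟩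

/-! ### §3 the head — the registry letter `stub_F11` by name -/

/-- **F-11 by ROAD A — the registered letter `stub_F11` (registry `Cruxes/HDel/Lines/F1ExtHodgeType.lean` v5.9 :327; P1 head
`Cruxes/HDel/Lines/F0_SiegelModuli.lean` :155; parent `F11SmoothRoadA.lean` :266) TOKEN FOR TOKEN, as a `Theorems/`-homed theorem:**
for `0 < g`, `δ` a polarisation type, `3 ≤ N`, every fine moduli scheme `𝓜` of the Siegel functor that is locally of finite type over `ℚ`
is SMOOTH over `ℚ` — EGA IV 17.14.2 through «fine moduli» along PRINCIPAL small extensions (★ (A2♯) p795680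
`SiegelFineModuliScheme.smooth_of_forall_principalSmallExtension_exists_polarizedLift`) over `stub_polarizedLift_holds`, instantiated at the
level-free part `(P₀.A, P₀.relDim, P₀.D, P₀.hatNormalised, P₀.pol)` of each test triple.  Cone: α1-P (G0 ★ ▸ G1-P ▸ G2-P), αP ★, α2′ ★, (7) ★, (A2♯) ★.
[cite: Lan2013PELCompactifications, Thm. 1.4.1.11 (p. 91) and §2.2.1 (p. 130)]
[cite: MumfordFogartyKirwan1994, Ch. 7 §3 Theorem 7.9 (p. 139) and App. 7A (pp. 234–235)] [cite: EGAIV4, Prop. (17.14.2) p. 98] -/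
theorem stub_F11_holds : ∀ (g N : ℕ) (δ : Fin g → ℕ), 0 < g → IsPolarizationType δ → 3 ≤ N →
    ∀ 𝓜 : SiegelFineModuliScheme g N δ, LocallyOfFiniteType 𝓜.M.hom → Smooth 𝓜.M.hom := by
  intro g N δ _hg _hδ hN 𝓜 _hft
  -- EGA IV 17.14.2 through «fine moduli» needs lifts along PRINCIPAL small extensions only: ★ (A2♯) p795680
  exact 𝓜.smooth_of_forall_principalSmallExtension_exists_polarizedLift (by omega)
    fun A _ _ _ _ _ t ht0 htm htJ P₀ => stub_polarizedLift_holds g A t ht0 htm htJ P₀.A P₀.relDim P₀.D P₀.hatNormalised P₀.pol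

end Summit.HodgeConjecture.CorCM.Cruxes.HypDel.F11SmoothRoadA

end
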